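import Mathlib
import HarnessLib
import Summits.ValiantsHypothesis.ValiantsHypothesis.Theorems.LacunarySymmetroidMatrixDescartesProductPlusOnePivotableSector
import Summits.ValiantsHypothesis.ValiantsHypothesis.Theorems.LacunarySymmetroidMatrixDescartesProductPlusOneEulerRolle

/-!
# ValiantsHypothesis / LacunarySymmetroid — crux `MatrixDescartes` (stmt-ValiantsHypothesis-18050, V1),
# LINE (A) «product_plus_one»: PIVOTABLE companies — the MEMBER bound `Z₊(c·X^{m d_{l₀}} + ∏ f_j) ≤ 2m + 2`

Member currency (the class row `PPOLawAt` / `stub_polyLaw` side) of ✓ `eulerBoundPoly_pivotable` (`…ProductPlusOnePivotableSector`), through the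
coupling-free reduction ✓ `card_pos_roots_class_le_euler` (`…ProductPlusOneEulerRolle`): for a split-signed PIVOTABLE company (every `K`, any
support, every coupling `l₀`) and every real `c`, the class member `C c·X^{m·d_{l₀}} + ∏_j f_j` has at most `2m + 2` positive zeros.

HONEST FRAMING: a sector theorem in member currency; closes NO stub by name; NOT `ClassRowK3Linear`, `PPOPolyLaw`, `ProductPlusOneMDR`,
`MatrixDescartes`; `VP ≠ VNP` is NOT proved.  No definitions, no named facts, no sorry.

[folklore] Composition of two tree theorems; no citation needed.
-/

set_option linter.dupNamespace false

namespace Summit.ValiantsHypothesis.ValiantsHypothesis.Theorems.LacunarySymmetroidMatrixDescartes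

namespace ProductPlusOne

open Polynomial Finset
open scoped BigOperators

/-- ★★ **PIVOTABLE companies, member currency: `Z₊(C c·X^{m d_{l₀}} + ∏_j f_j) ≤ 2m + 2`** (every `K`, any support, every coupling, every
real `c`). [this file's theorem] -/
theorem class_pos_roots_le_of_pivotable {m K : ℕ} (d : Fin K → ℕ) (a : Fin m → Fin K → ℝ) (l₀ : Fin K)
    (hlow : ∀ j l, d l < d l₀ → 0 ≤ a j l) (hup : ∀ j l, d l₀ < d l → a j l ≤ 0)
    (hpiv : ∀ z z' : ℝ, 0 < z → z ≤ z' →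
      (∀ j, (∀ t ∈ Set.Icc z z', 0 < (∑ l, C (a j l) * X ^ (d l) : ℝ[X]).eval t) ∨
        (∀ t ∈ Set.Icc z z', (∑ l, C (a j l) * X ^ (d l) : ℝ[X]).eval t < 0)) →
      ∃ lp : Fin K,
        (∀ x ∈ Set.Icc z z', ∀ l, d lp < d l →
          (d l < d l₀ → 0 < ∑ j, a j l * (x ^ (d l₀) / (∑ l', C (a j l') * X ^ (d l') : ℝ[X]).eval x)) ∧
          (d l₀ < d l → ∑ j, a j l * (x ^ (d l₀) / (∑ l', C (a j l') * X ^ (d l') : ℝ[X]).eval x) < 0)) ∧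
        (∀ x ∈ Set.Icc z z', ∀ l, d l < d lp →
          (d l < d l₀ → ∑ j, a j l * (x ^ (d l₀) / (∑ l', C (a j l') * X ^ (d l') : ℝ[X]).eval x) < 0) ∧
          (d l₀ < d l → 0 < ∑ j, a j l * (x ^ (d l₀) / (∑ l', C (a j l') * X ^ (d l') : ℝ[X]).eval x))) ∧
        (∃ l, d l ≠ d lp ∧ d l ≠ d l₀))
    (c : ℝ) :
    ((C c * X ^ (m * d l₀) + ∏ j, ∑ l, C (a j l) * X ^ (d l) : ℝ[X]).roots.toFinset.filter (fun t => 0 < t)).card ≤ 2 * m + 2 := by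
  have h1 := card_pos_roots_class_le_euler d a l₀ c
  have h2 := eulerBoundPoly_pivotable d a l₀ hlow hup hpiv
  omega

end ProductPlusOne

end Summit.ValiantsHypothesis.ValiantsHypothesis.Theorems.LacunarySymmetroidMatrixDescartes
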